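import Summits.QuantumFields.YangMills.Theorems.UnitScaleTiltProp7FibreQDefect
import Summits.QuantumFields.YangMills.Theorems.UnitScaleTiltProp7TrueLinDefectBound
import HarnessLib

/-!
# Route `UnitScaleTilt`, crux K1 «MinimiserStabilityRegPr» (stmt-QuantumFields-19200), route-R [RP] curved, the `Q`-junction (R2), file D —
# THE PER-LEVEL SUPS OF THE LEVEL RATIOS IN A LOCAL GAUGE: `‖pertVar Ū₀^{(j)} W̄^{(j)} (b)‖ ≤ 2(d+1)L^j·ρ` whenever, in SOME finest gauge `σ`, `U₀^σ` is `η`-flat and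
# `‖W − U₀‖ ≤ ρ` on the finest bonds under the two `j`-blocks of `b`; hence the two-block masses `(d+2)L·Σ_{b∈N(c)}‖Y_j(b)‖ ≤ 4d(d+1)(d+2)·L^{d+1+j}·ρ` of file C

Cell `ym3-torus`, keyed width hand `ym-routeR-w3` (D-0154 (3c); (R2) LOCATED 2026-08-28 08:42Z; residual binder (B6) of the census 09:18Z).  THEOREMS ONLY (0 `def`, 0 `sorry`);
`--supports stmt-QuantumFields-19200`, count-neutral.  YM₃ on T³ is a ladder rung (R3), not the Clay problem; nothing here claims the stub, the crux, d = 4 or the mass gap.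

THE POINT.  File C (✓ `…FibreTrueLinDefectMass`) takes per-level bounds `μ_j ≥ (d+2)L·Σ_{b∈N(c)}‖Y_j(b)‖` of the nonlinear level ratios `Y_j = pertVar Ū₀^{(j)}W̄^{(j)}`.  At a
CURVED background no global window is available, but ★routeR-w3 g0's cut-off technique (✓ p609586 `Prop7FibreQDefect.norm_linAvgIterM_gauged_sub_le_of_iter_eq`) runs level by
level: the `j`-fold averages at `b` see only the finest bonds under the two `j`-blocks of `b` (★alpha-2's ✓ `AvgIterLocality.iter_blockAvg_congr₂_of_blocks_subset`), are
gauge covariant (✓ `T4Continuum.iter_gaugeAct`), and the every-`L` two-field row (★w5-19936's ✓ `EMLIterUniformAllL.norm_iter_sub_iter_sub_iterLin_le_uniform_allL`, FIRST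
conjunct, at level `j`) applied to the cut-off pair (`W^σ`, `U₀^σ` inside the stencil, `1` outside) gives `‖W̄^{(j)}(b) − Ū₀^{(j)}(b)‖ ≤ 2(d+1)L^jρ`; unitarity turns this into the
ratio bound.  §2 sums over ★w2-20520's two-block neighbourhood (`card_nbhd_le`).  DISPLAYED: the gauge `σ`, the stencil `N`, the flatness `η` and the sup `ρ` — the (T1)-type
local-gauge input of the cell (★w4-19200 g2's located centre-axial gauge, `η = O(ε₀L^{−(K−n)})`), exactly as in ✓ p609586.

WHAT IS PROVED (ns `…Theorems.Prop7FibreLevelSup`; `SU(n)`, any `P`, `j ≤ m + K`).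
* §1 ★★ `norm_pertVar_iter_le_of_gauge` — the per-bond sup of the level-`j` ratio from local gauge data.
* §2 ★ `twoBlockMass_le_of_gauge` — `(d+2)L·Σ_{b∈N(c)}‖Y_j(b)‖ ≤ (d+2)L·(2dL^d)·(2(d+1)L^jρ)` from ONE gauge∕stencil covering the neighbourhood of the `(j+1)`-bond `c`.
HONEST SCOPE.  A re-run of ✓ p609586 §1 at level `j` without the fibre identity (first conjunct only) plus counting; nothing of [Balaban1985Averaging] is asserted beyond the tree.

References: T. Bałaban, CMP 98 (1985) 17–51 [Balaban1985Averaging] ((11)–(13) p.19, Prop. 4 (134)–(135) p.38); CMP 102 (1985) 277–309 [Balaban1985Variational] ((15) p.280);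
CMP 109 (1987) 249–301 [Balaban1987RG1] ((0.4)+(0.11) p.253).
-/

set_option autoImplicit false

noncomputable section

open scoped BigOperators Matrix.Norms.L2Operator

namespace Summit.QuantumFields.YangMills.Theorems.Prop7FibreLevelSup

open Literature.MathematicalPhysics.QuantumFieldTheory.Balaban1983to89
open Literature.MathematicalPhysics.QuantumFieldTheory.Balaban1983to89.B5Eq118OneStroke (iterBlockOf)
open Finset T4Continuum BlockAveraging ExpMeanLog BlockAveragingEMLLinearised BlockAveragingEMLLinearisedBackground
open Summit.QuantumFields.YangMills.Theorems.LinearLiftMatrix (linAvgIterM linAvgIterM_zero linAvgIterM_succ)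
open Summit.QuantumFields.YangMills.Theorems.EMLIterUniformAllL (norm_iter_sub_iter_sub_iterLin_le_uniform_allL)
open Summit.QuantumFields.YangMills.Theorems.AvgIterLocality (iter_blockAvg_congr₂_of_blocks_subset)
open Summit.QuantumFields.YangMills.Theorems.CovLinAvgFrame (coe_gaugeAct)
open Summit.QuantumFields.YangMills.Theorems.Prop7HolRatioPerStep (coe_mul_star_self)
open Summit.QuantumFields.YangMills.Theorems.Prop7TrueLinDefectBound (card_nbhd_le)

variable {P : Params} {n : Type*} [Fintype n] [DecidableEq n] [Nonempty n]

/-! ## §1 ★★ The per-bond sup of the level ratio from local gauge data -/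

/-- ★★ **THE LEVEL-`j` RATIO IS SMALL WHEREVER THE PAIR IS CLOSE AND THE BACKGROUND IS FLAT IN SOME GAUGE, LOCALLY.**  `j ≤ m + K`; `σ` ANY finest gauge transformation; `N`
ANY set of finest sites containing the two `j`-blocks of the level-`j` bond `b`; on the finest bonds with both ends in `N`: `‖(U₀^σ)_e − 1‖ ≤ η` and `‖W_e − U₀,e‖ ≤ ρ`; the four
smallness rows of the every-`L` two-field theorem at level `j` and `(ρ, η)`.  THEN `‖pertVar Ū₀^{(j)} W̄^{(j)} (b)‖ ≤ 2·((d+1)L^j·ρ)`.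
[cite: Balaban1985Averaging, (11)–(13) p.19, Prop. 4 (134)–(135) p.38; Balaban1987RG1, (0.4)+(0.11) p.253] -/
theorem norm_pertVar_iter_le_of_gauge {j : ℕ} (hj : j ≤ P.m + P.K) (σ : GaugeTransf P 0 (Matrix.specialUnitaryGroup n ℂ))
    (N : Set (Site P 0)) (b : PBond P j) (hN : ∀ x : Site P 0, (iterBlockOf j x = b.src ∨ iterBlockOf j x = b.tgt) → x ∈ N)
    (W U₀ : GaugeField P 0 (Matrix.specialUnitaryGroup n ℂ)) {ρ η : ℝ} (hρ0 : 0 ≤ ρ) (hη0 : 0 ≤ η)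
    (hU₀ : ∀ e : PBond P 0, e.src ∈ N → e.tgt ∈ N → ‖((GaugeField.gaugeAct σ U₀ e : Matrix.specialUnitaryGroup n ℂ) : Matrix n n ℂ) - 1‖ ≤ η)
    (hρ : ∀ e : PBond P 0, e.src ∈ N → e.tgt ∈ N → ‖((W e : Matrix.specialUnitaryGroup n ℂ) : Matrix n n ℂ) - ((U₀ e : Matrix.specialUnitaryGroup n ℂ) : Matrix n n ℂ)‖ ≤ ρ)
    (hmδ : (((P.d : ℝ) + 1) * ((18 : ℝ) ^ P.d * (2 + ((P.d : ℝ) + 1) * (18 : ℝ) ^ P.d)) * (324 * (((P.d + 2) * P.L : ℕ) : ℝ) ^ 2) /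
        ((P.L : ℝ) * ((P.L : ℝ) - 1))) * (((P.d : ℝ) + 1) * (P.L : ℝ) ^ j * η) ≤ 1)
    (h200 : 200 * (((P.d + 2) * P.L : ℕ) : ℝ) * ((((P.d : ℝ) + 1) * (P.L : ℝ) ^ j * ρ) + (((P.d : ℝ) + 1) * (P.L : ℝ) ^ j * η)) ≤ 1)
    (hm : (((P.d : ℝ) + 1) * ((18 : ℝ) ^ P.d * (2 + ((P.d : ℝ) + 1) * (18 : ℝ) ^ P.d)) * (5200 * (((P.d + 2) * P.L : ℕ) : ℝ) ^ 2) /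
        ((P.L : ℝ) * ((P.L : ℝ) - 1))) * ((((P.d : ℝ) + 1) * (P.L : ℝ) ^ j * ρ) + (((P.d : ℝ) + 1) * (P.L : ℝ) ^ j * η)) ≤ 1)
    (hNδ : 4 * (((P.d + 2) * P.L : ℕ) : ℝ) * ((((P.d : ℝ) + 1) * (P.L : ℝ) ^ j * ρ) + (((P.d : ℝ) + 1) * (P.L : ℝ) ^ j * η)) < deltaSU n) :
    ‖pertVar (Averaging.iter (fun i => blockAvg (P := P) (j := i) (expMeanLogSU (n := n))) j U₀) (Averaging.iter (fun i => blockAvg (P := P) (j := i) (expMeanLogSU (n := n))) j W) b‖ ≤ 2 * (((P.d : ℝ) + 1) * (P.L : ℝ) ^ j * ρ) := by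
  classical
  set av : (i : ℕ) → Averaging P i (Matrix.specialUnitaryGroup n ℂ) := fun i => blockAvg (P := P) (j := i) (expMeanLogSU (n := n)) with hav
  have hQ0 : ∀ Y : PBond P 0 → Matrix n n ℂ, linAvgIterM 0 Y = Y := fun Y => linAvgIterM_zero Y
  have hQs : ∀ (i : ℕ) (Y : PBond P 0 → Matrix n n ℂ) (c : PBond P (i + 1)), linAvgIterM (i + 1) Y c = linAvg (linAvgIterM i Y) c :=
    fun i Y c => linAvgIterM_succ i Y c
  -- the cut-off pair
  let InN : PBond P 0 → Prop := fun e => e.src ∈ N ∧ e.tgt ∈ N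
  let W₁ : GaugeField P 0 (Matrix.specialUnitaryGroup n ℂ) := fun e => if InN e then GaugeField.gaugeAct σ W e else 1
  let W₂ : GaugeField P 0 (Matrix.specialUnitaryGroup n ℂ) := fun e => if InN e then GaugeField.gaugeAct σ U₀ e else 1
  have hW₁_in : ∀ e : PBond P 0, e.src ∈ N → e.tgt ∈ N → W₁ e = GaugeField.gaugeAct σ W e := fun e h1 h2 => if_pos ⟨h1, h2⟩
  have hW₂_in : ∀ e : PBond P 0, e.src ∈ N → e.tgt ∈ N → W₂ e = GaugeField.gaugeAct σ U₀ e := fun e h1 h2 => if_pos ⟨h1, h2⟩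
  have hW₂_one : ∀ e, ‖((W₂ e : Matrix.specialUnitaryGroup n ℂ) : Matrix n n ℂ) - 1‖ ≤ η := by
    intro e
    by_cases he : InN e
    · have e1 : W₂ e = GaugeField.gaugeAct σ U₀ e := if_pos he
      rw [e1]; exact hU₀ e he.1 he.2
    · have e1 : W₂ e = 1 := if_neg he
      rw [e1]; simpa using hη0
  have hW₁_W₂ : ∀ e, ‖((W₁ e : Matrix.specialUnitaryGroup n ℂ) : Matrix n n ℂ) - ((W₂ e : Matrix.specialUnitaryGroup n ℂ) : Matrix n n ℂ)‖ ≤ ρ := by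
    intro e
    by_cases he : InN e
    · have e1 : W₁ e = GaugeField.gaugeAct σ W e := if_pos he
      have e2 : W₂ e = GaugeField.gaugeAct σ U₀ e := if_pos he
      rw [e1, e2, coe_gaugeAct, coe_gaugeAct, ← sub_mul, ← mul_sub, CStarRing.norm_mul_mem_unitary _ (Unitary.star_mem (σ e.tgt).2.1),
        CStarRing.norm_mem_unitary_mul _ (σ e.src).2.1]
      exact hρ e he.1 he.2
    · have e1 : W₁ e = 1 := if_neg he
      have e2 : W₂ e = 1 := if_neg he
      rw [e1, e2, sub_self, norm_zero]; exact hρ0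
  -- the two-field row (first conjunct) on the cut-offs at level `j`, bond `b`
  have h2f := norm_iter_sub_iter_sub_iterLin_le_uniform_allL linAvgIterM hQ0 hQs W₁ W₂ hη0 hρ0 hW₂_one hW₁_W₂ j hj hmδ h200 hm hNδ
  obtain ⟨hrow, -⟩ := h2f j le_rfl b
  -- locality and covariance
  have h1 : Averaging.iter av j W₁ b = Averaging.iter av j (GaugeField.gaugeAct σ W) b :=
    iter_blockAvg_congr₂_of_blocks_subset (expMeanLogSU (n := n)) hj N hW₁_in b hN
  have h2 : Averaging.iter av j W₂ b = Averaging.iter av j (GaugeField.gaugeAct σ U₀) b :=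
    iter_blockAvg_congr₂_of_blocks_subset (expMeanLogSU (n := n)) hj N hW₂_in b hN
  have h1' : ((Averaging.iter av j W₁ b : Matrix.specialUnitaryGroup n ℂ) : Matrix n n ℂ)
      = (transfUp σ j b.src : Matrix n n ℂ) * ((Averaging.iter av j W b : Matrix.specialUnitaryGroup n ℂ) : Matrix n n ℂ) * star (transfUp σ j b.tgt : Matrix n n ℂ) := by
    rw [h1, T4Continuum.iter_gaugeAct av σ j hj W, coe_gaugeAct]
  have h2' : ((Averaging.iter av j W₂ b : Matrix.specialUnitaryGroup n ℂ) : Matrix n n ℂ)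
      = (transfUp σ j b.src : Matrix n n ℂ) * ((Averaging.iter av j U₀ b : Matrix.specialUnitaryGroup n ℂ) : Matrix n n ℂ) * star (transfUp σ j b.tgt : Matrix n n ℂ) := by
    rw [h2, T4Continuum.iter_gaugeAct av σ j hj U₀, coe_gaugeAct]
  have hdiff : ‖((Averaging.iter av j W b : Matrix.specialUnitaryGroup n ℂ) : Matrix n n ℂ) - ((Averaging.iter av j U₀ b : Matrix.specialUnitaryGroup n ℂ) : Matrix n n ℂ)‖ ≤ 2 * (((P.d : ℝ) + 1) * (P.L : ℝ) ^ j * ρ) := by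
    have e : ((Averaging.iter av j W₁ b : Matrix.specialUnitaryGroup n ℂ) : Matrix n n ℂ) - ((Averaging.iter av j W₂ b : Matrix.specialUnitaryGroup n ℂ) : Matrix n n ℂ)
        = (transfUp σ j b.src : Matrix n n ℂ) * (((Averaging.iter av j W b : Matrix.specialUnitaryGroup n ℂ) : Matrix n n ℂ) - ((Averaging.iter av j U₀ b : Matrix.specialUnitaryGroup n ℂ) : Matrix n n ℂ)) * star (transfUp σ j b.tgt : Matrix n n ℂ) := by
      rw [h1', h2']; noncomm_ring
    rw [e, CStarRing.norm_mul_mem_unitary _ (Unitary.star_mem (transfUp σ j b.tgt).2.1), CStarRing.norm_mem_unitary_mul _ (transfUp σ j b.src).2.1] at hrow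
    exact hrow
  -- the ratio: `‖XV* − 1‖ = ‖(X − V)V*‖ = ‖X − V‖`
  rw [pertVar_eq]
  have e2 : (((Averaging.iter (fun i => blockAvg (P := P) (j := i) (expMeanLogSU (n := n))) j W) b : Matrix.specialUnitaryGroup n ℂ) : Matrix n n ℂ) * star (((Averaging.iter (fun i => blockAvg (P := P) (j := i) (expMeanLogSU (n := n))) j U₀) b : Matrix.specialUnitaryGroup n ℂ) : Matrix n n ℂ) - 1
      = ((((Averaging.iter (fun i => blockAvg (P := P) (j := i) (expMeanLogSU (n := n))) j W) b : Matrix.specialUnitaryGroup n ℂ) : Matrix n n ℂ) - (((Averaging.iter (fun i => blockAvg (P := P) (j := i) (expMeanLogSU (n := n))) j U₀) b : Matrix.specialUnitaryGroup n ℂ) : Matrix n n ℂ)) * star (((Averaging.iter (fun i => blockAvg (P := P) (j := i) (expMeanLogSU (n := n))) j U₀) b : Matrix.specialUnitaryGroup n ℂ) : Matrix n n ℂ) := by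
    rw [sub_mul, coe_mul_star_self]
  rw [e2, CStarRing.norm_mul_mem_unitary _ (Unitary.star_mem ((Averaging.iter (fun i => blockAvg (P := P) (j := i) (expMeanLogSU (n := n))) j U₀) b).2.1)]
  exact hdiff

/-! ## §2 ★ The two-block masses of file C from one gauge per neighbourhood -/

/-- ★ **THE TWO-BLOCK MASS OF A LEVEL RATIO FROM LOCAL GAUGE DATA**: `j + 1 ≤ m + K`; `c` a `(j+1)`-bond; ONE gauge `σ` and ONE stencil `N` containing the two `j`-blocks of EVERY
`j`-bond `b` of the neighbourhood `N(c) = {b : blockOf b₋ ∈ {c₋, c₊}}`, with `U₀^σ` `η`-flat and `‖W − U₀‖ ≤ ρ` on `N`, smallness rows at level `j`.  THEN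
`(d+2)L·Σ_{b∈N(c)}‖pertVar Ū₀^{(j)} W̄^{(j)} (b)‖ ≤ (d+2)L·(2dL^d)·(2(d+1)L^jρ)` — the `μ_j` of ✓ `…FibreTrueLinDefectMass` from the (T1)-type local-gauge input.
[cite: Balaban1985Averaging, Prop. 4 (134)–(135) p.38; Balaban1987RG1, (0.3)–(0.4) pp.252–253] -/
theorem twoBlockMass_le_of_gauge {j : ℕ} (hj : j + 1 ≤ P.m + P.K) (c : PBond P (j + 1)) (σ : GaugeTransf P 0 (Matrix.specialUnitaryGroup n ℂ)) (N : Set (Site P 0))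
    (hN : ∀ b : PBond P j, (blockOf b.src = c.src ∨ blockOf b.src = c.tgt) → ∀ x : Site P 0, (iterBlockOf j x = b.src ∨ iterBlockOf j x = b.tgt) → x ∈ N)
    (W U₀ : GaugeField P 0 (Matrix.specialUnitaryGroup n ℂ)) {ρ η : ℝ} (hρ0 : 0 ≤ ρ) (hη0 : 0 ≤ η)
    (hU₀ : ∀ e : PBond P 0, e.src ∈ N → e.tgt ∈ N → ‖((GaugeField.gaugeAct σ U₀ e : Matrix.specialUnitaryGroup n ℂ) : Matrix n n ℂ) - 1‖ ≤ η)
    (hρ : ∀ e : PBond P 0, e.src ∈ N → e.tgt ∈ N → ‖((W e : Matrix.specialUnitaryGroup n ℂ) : Matrix n n ℂ) - ((U₀ e : Matrix.specialUnitaryGroup n ℂ) : Matrix n n ℂ)‖ ≤ ρ)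
    (hmδ : (((P.d : ℝ) + 1) * ((18 : ℝ) ^ P.d * (2 + ((P.d : ℝ) + 1) * (18 : ℝ) ^ P.d)) * (324 * (((P.d + 2) * P.L : ℕ) : ℝ) ^ 2) /
        ((P.L : ℝ) * ((P.L : ℝ) - 1))) * (((P.d : ℝ) + 1) * (P.L : ℝ) ^ j * η) ≤ 1)
    (h200 : 200 * (((P.d + 2) * P.L : ℕ) : ℝ) * ((((P.d : ℝ) + 1) * (P.L : ℝ) ^ j * ρ) + (((P.d : ℝ) + 1) * (P.L : ℝ) ^ j * η)) ≤ 1)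
    (hm : (((P.d : ℝ) + 1) * ((18 : ℝ) ^ P.d * (2 + ((P.d : ℝ) + 1) * (18 : ℝ) ^ P.d)) * (5200 * (((P.d + 2) * P.L : ℕ) : ℝ) ^ 2) /
        ((P.L : ℝ) * ((P.L : ℝ) - 1))) * ((((P.d : ℝ) + 1) * (P.L : ℝ) ^ j * ρ) + (((P.d : ℝ) + 1) * (P.L : ℝ) ^ j * η)) ≤ 1)
    (hNδ : 4 * (((P.d + 2) * P.L : ℕ) : ℝ) * ((((P.d : ℝ) + 1) * (P.L : ℝ) ^ j * ρ) + (((P.d : ℝ) + 1) * (P.L : ℝ) ^ j * η)) < deltaSU n) :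
    (((P.d + 2) * P.L : ℕ) : ℝ) * ∑ b ∈ (univ.filter (fun b : PBond P j => blockOf b.src = c.src ∨ blockOf b.src = c.tgt)), ‖pertVar (Averaging.iter (fun i => blockAvg (P := P) (j := i) (expMeanLogSU (n := n))) j U₀) (Averaging.iter (fun i => blockAvg (P := P) (j := i) (expMeanLogSU (n := n))) j W) b‖
      ≤ (((P.d + 2) * P.L : ℕ) : ℝ) * ((2 * P.d * (P.L : ℝ) ^ P.d) * (2 * (((P.d : ℝ) + 1) * (P.L : ℝ) ^ j * ρ))) := by
  have hj' : j ≤ P.m + P.K := by omega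
  refine mul_le_mul_of_nonneg_left ?_ (Nat.cast_nonneg _)
  have hpt : ∀ b ∈ (univ.filter (fun b : PBond P j => blockOf b.src = c.src ∨ blockOf b.src = c.tgt)), ‖pertVar (Averaging.iter (fun i => blockAvg (P := P) (j := i) (expMeanLogSU (n := n))) j U₀) (Averaging.iter (fun i => blockAvg (P := P) (j := i) (expMeanLogSU (n := n))) j W) b‖ ≤ 2 * (((P.d : ℝ) + 1) * (P.L : ℝ) ^ j * ρ) := by
    intro b hb
    have hb' := (Finset.mem_filter.mp hb).2
    exact norm_pertVar_iter_le_of_gauge hj' σ N b (hN b hb') W U₀ hρ0 hη0 hU₀ hρ hmδ h200 hm hNδ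
  calc ∑ b ∈ (univ.filter (fun b : PBond P j => blockOf b.src = c.src ∨ blockOf b.src = c.tgt)), ‖pertVar (Averaging.iter (fun i => blockAvg (P := P) (j := i) (expMeanLogSU (n := n))) j U₀) (Averaging.iter (fun i => blockAvg (P := P) (j := i) (expMeanLogSU (n := n))) j W) b‖
      ≤ ∑ b ∈ (univ.filter (fun b : PBond P j => blockOf b.src = c.src ∨ blockOf b.src = c.tgt)), 2 * (((P.d : ℝ) + 1) * (P.L : ℝ) ^ j * ρ) := Finset.sum_le_sum hpt
    _ = (((univ.filter (fun b : PBond P j => blockOf b.src = c.src ∨ blockOf b.src = c.tgt))).card : ℝ) * (2 * (((P.d : ℝ) + 1) * (P.L : ℝ) ^ j * ρ)) := by rw [Finset.sum_const, nsmul_eq_mul]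
    _ ≤ (2 * P.d * (P.L : ℝ) ^ P.d) * (2 * (((P.d : ℝ) + 1) * (P.L : ℝ) ^ j * ρ)) := mul_le_mul_of_nonneg_right (card_nbhd_le (P := P) hj c) (by positivity)

end Summit.QuantumFields.YangMills.Theorems.Prop7FibreLevelSup

end
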